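import Summits.NavierStokesRegularity.FluidComputer.BlockQuadReach
import Summits.NavierStokesRegularity.FluidComputer.BlockReachCalculus

/-!
# Fluid computer, block design — NO-GO: the re-typed residue on the loaded region is FALSE as typed

HONEST FRAMING: low prior, high value-of-information experiment on Tao's machine paradigm; NOT a
claim that NS blows up. This file is a NEGATIVE result about this lane's OWN residue: it proves,
unconditionally, that the structure `OpenReachBound 𝒟 P (quadVF k η) (loadedRegion η) ε` of
`BlockQuadReach.lean` — the hypothesis of `ns_blowup_of_quadReachBound` and of
`energy_reaches_all_scales_of_quadReachBound` — is UNINHABITED, for every coupling `k`, every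
`η`, every parameter set `P` and EVERY defect level `ε` (however large). Those two theorems remain
correct implications and carry no information. The lane did not claim their hypothesis (it was
typed "presumed FALSE, never claimed"); what is new is that the falsity is TRIVIAL and is not the
analytic question (β1)/(β2b) the docstrings pointed to, but plain viscosity (β3) at large amplitude.

WHAT IS PROVED. (§1) `OpenReachBound.false_of_ray` [folklore]: let `F`, `U`, `ε` be ANY design
field, working region and defect level such that `U` contains a ray `{(A, 0) : A ≥ A₀}` of clean
input states on which the input component of `F` vanishes (`(F (A, 0)).1 = 0`). Then
`OpenReachBound 𝒟 P F U ε` is empty. Proof: take the clean design state `a = recon n (A, 0) =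
A√E_n ψ_n` (zero junk, readout `(A, 0) ∈ U`, so both guards of the `defect` field hold at `t = 0`)
and the true mild Navier–Stokes solution `u` from `a` (`h10MildTheory_holds.localExistence`). By
`hasDerivWithinAt_read_fst_clean` (`BlockReachCalculus.lean`) the input readout has right derivative
`-Λ_n A` at `t = 0`, `Λ_n = viscRate 𝒟 n ≥ 4π²` (heat semigroup on `ψ_n`; the nonlinearity
contributes `⟨B(a,a), ψ_n⟩ = 0`); right derivatives within `[0, ∞)` are unique, so the `defect`
field forces `unit n · Λ_n · A ≤ ε`, absurd for `A > ε / (unit n · Λ_n)`.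
(§2) `not_openReachBound_quad`, `isEmpty_openReachBound_quad`: the instance `F = quadVF k η`
(`(quadVF k η (A, 0)).1 = -kη·A·0 = 0`), `U = loadedRegion η ∋ (A, 0)` for `A ≥ 2`. The same
applies verbatim to every energy-conserving field `ω(a,b)·(-ηb, a)` of `BlockQuadGate.lean` and to
any working region unbounded along the input axis.

HONEST READING. (1) What this kills: the lane's sharpest typing (gen 34) of the residue, in the
form "instantaneous readout law, ABSOLUTELY `ε`-close to a CONSERVATIVE design field, uniformly on
an UNBOUNDED loaded region". It does NOT touch the design-level theorems (`quadReachCertificate`,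
the transit gate, the junk budget), bp1's reach layer, or the whole-tick residue `OpenIdeaBound` of
`BlockQuadClock.lean` (whose refutation would need control of a trajectory over a time interval,
not one instant). (2) Why it is trivial and what it corrects: `BlockQuadGate.lean` (γ) and
`ASSEMBLY.md` §2g.9(j)(β3) booked viscosity as "a diagonal damping, harmless in shape … slows
transfer at small amplitude (the open window's large-`a` end is the favourable one)". That is a
statement about the RELATIVE size `unit n Λ_n / (k a)` of the damping, which indeed decreases with
`a`; but the residue was typed with an ABSOLUTE, amplitude-uniform tolerance `ε`, and the absolute
viscous defect `unit n Λ_n · a` GROWS with `a` — on an unbounded window no constant `ε` absorbs it.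
So the typing, not the physics it meant, is what fails. (3) What an honest re-typing must do (NOT
done here; recorded as the next design step): either (a) put the viscous diagonal INTO the design
field, `F(a,b) = (-kηab - γ a, ka² - γ' b)` with `γ = unit n Λ_n`, `γ' = unit n Λ_{n+1}` (exact for
the Laplacian on the two modes, which have disjoint Fourier supports; `n`-uniform constants are a
condition on the clock and the spec sheet), and re-prove the transit theorem of
`BlockQuadTransit.lean` for the DAMPED field (its pseudo-orbits lose pair energy at rate `≤ 2γ'`,
so reach across the window needs `γ' ≪ k`: a genuine large-Reynolds-number condition on the seed,
PLAUSIBLE-class, to be computed not assumed); or (b) make the tolerance amplitude-relative,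
`‖unit • W - F z‖ ≤ ε (1 + ‖z‖)`, under which bp1's uniform-defect bootstrap
(`ReachCircuit.reach_sharp`) does not apply as proved; or (c) bound the working region in `a`
(back to the amplitude drift of bounded windows, `BlockOpenWindow.lean`). (4) NOT claimed: that any
repaired residue holds (each is idea-bound and presumed false for the two-wavelet design, (β1)/(β2)
untouched), nor anything about blow-up.
-/

noncomputable section

open MeasureTheory Set Filter Topology Metric
open scoped ENNReal NNReal

namespace Summit.NavierStokesRegularity.FluidComputer

open Literature.Analysis.FluidPDE Literature.Analysis.FluidPDE.Tao2016
open Literature.Analysis.FluidPDE.FluidComputer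
open Literature.Analysis.FunctionSpaces (eFourierSobolevNorm)
open Summit.NavierStokesRegularity.NavierStokesRegularity.Theorems.FluidComputer

namespace BlockDesign

variable {𝒟 : CascadeWaveletData 1 1} {S : CascadeSpecs} {P : Params S}

/-! ### §1. The no-go for a design field with vanishing input component on a clean input ray -/

/-- **NO-GO.** If the working region `U` contains the clean input ray `{(A, 0) : A ≥ A₀}` and the
design field `F` has vanishing input component on it, then the guarded instantaneous readout law
`OpenReachBound 𝒟 P F U ε` is violated by the TRUE Navier–Stokes equation at `t = 0` along the
trajectory from the clean design state `A√E_n ψ_n`, `A > ε / (unit n · Λ_n)`: the readout's input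
component has right derivative `-Λ_n A` (viscosity, `BlockReachCalculus.lean`), not within `ε` of
`0` after rescaling. Holds for every `ε`. [folklore] -/
theorem OpenReachBound.false_of_ray {F : ℝ × ℝ → ℝ × ℝ} {U : Set (ℝ × ℝ)} {ε : ℝ}
    (H : OpenReachBound 𝒟 P F U ε) (n : ℕ) {A₀ : ℝ}
    (hU : ∀ A : ℝ, A₀ ≤ A → ((A, 0) : ℝ × ℝ) ∈ U)
    (hF : ∀ A : ℝ, A₀ ≤ A → (F (A, 0)).1 = 0) : False := by
  have hΛ := viscRate_pos 𝒟 n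
  have hun := H.unit_pos n
  have hpos : 0 < H.unit n * viscRate 𝒟 n := mul_pos hun hΛ
  set A : ℝ := max (max A₀ 0) (ε / (H.unit n * viscRate 𝒟 n) + 1) with hA
  have hA₀ : A₀ ≤ A := (le_max_left _ _).trans (le_max_left _ _)
  have hA0 : 0 ≤ A := (le_max_right _ _).trans (le_max_left _ _)
  have hAε : ε < H.unit n * viscRate 𝒟 n * A := by
    have h1 : ε / (H.unit n * viscRate 𝒟 n) + 1 ≤ A := le_max_right _ _
    have h2 : ε / (H.unit n * viscRate 𝒟 n) * (H.unit n * viscRate 𝒟 n) = ε :=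
      div_mul_cancel₀ _ hpos.ne'
    nlinarith
  -- the true trajectory from the clean loaded design state `A√E_n ψ_n`
  have ha : MemH10df (recon 𝒟 S n (A, 0)) := memH10df_recon 𝒟 S n _
  obtain ⟨T, hT, u, hu⟩ := h10MildTheory_holds.localExistence _ ha
  have hu0 : u 0 = recon 𝒟 S n (A, 0) := initial_eq hu ⟨le_rfl, hT⟩ ha
  have hread : read 𝒟 S n (u 0) = (A, 0) := by rw [hu0, read_recon]
  have hjunk : junk 𝒟 P n (u 0) < ENNReal.ofReal (H.jbar * Real.sqrt (S.Emin n)) := by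
    rw [hu0, junk_recon]
    exact ENNReal.ofReal_pos.2 (mul_pos (P.jrun_pos.trans H.jrun_lt_jbar) (sqrt_Emin_pos S n))
  obtain ⟨W, hW, hWε⟩ := H.defect n _ T u hu 0 le_rfl hT (hread ▸ hU A hA₀) hjunk
  -- two right derivatives of the input readout at `t = 0`: the claimed `W.1` and the true `-Λ_n A`
  have hW1 : HasDerivWithinAt (fun t => (read 𝒟 S n (u t)).1) W.1 (Ici 0) 0 :=
    (ContinuousLinearMap.fst ℝ ℝ ℝ).hasFDerivAt.comp_hasDerivWithinAt 0 hW
  have htrue := hasDerivWithinAt_read_fst_clean 𝒟 S n A hT hu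
  have hEq : W.1 = -(viscRate 𝒟 n * A) :=
    (uniqueDiffOn_Ici (0 : ℝ) 0 (Set.mem_Ici.2 le_rfl)).eq_deriv _ hW1 htrue
  -- the defect inequality, first component
  rw [hread] at hWε
  have h1 : |H.unit n * W.1 - (F (A, 0)).1| ≤ ε := by
    have h := (norm_fst_le (H.unit n • W - F (A, 0))).trans hWε
    simpa [Real.norm_eq_abs] using h
  rw [hEq, hF A hA₀, sub_zero, mul_neg, abs_neg,
    abs_of_nonneg (mul_nonneg hun.le (mul_nonneg hΛ.le hA0))] at h1
  linarith [mul_assoc (H.unit n) (viscRate 𝒟 n) A]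

/-! ### §2. The instance of `BlockQuadReach.lean`: `quadVF` on the loaded region -/

/-- Clean input states of amplitude `A ≥ 2` are loaded (`W = A² > 2`). [folklore] -/
theorem mem_loadedRegion_ray (η : ℝ) {A : ℝ} (hA : 2 ≤ A) : ((A, 0) : ℝ × ℝ) ∈ loadedRegion η := by
  show 2 < pairEnergy η (A, 0)
  unfold pairEnergy
  nlinarith

/-- The quadratic gate has no input component on the input ray: `(quadVF k η (A, 0)).1 = 0` — as
does every energy-conserving field `ω·(-ηb, a)`. [folklore] -/
theorem quadVF_fst_ray (k η A : ℝ) : (quadVF k η (A, 0)).1 = 0 := by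
  simp [quadVF]

/-- **NO-GO for the re-typed residue of `BlockQuadReach.lean`**: `OpenReachBound 𝒟 P (quadVF k η)
(loadedRegion η) ε` is false for every `k`, `η`, `P`, `ε`. In particular the hypothesis `H` of
`ns_blowup_of_quadReachBound` / `energy_reaches_all_scales_of_quadReachBound` is uninhabited.
[folklore] -/
theorem not_openReachBound_quad (k η ε : ℝ)
    (H : OpenReachBound 𝒟 P (quadVF k η) (loadedRegion η) ε) : False :=
  H.false_of_ray 0 (A₀ := 2) (fun _ hA => mem_loadedRegion_ray η hA)
    (fun A _ => quadVF_fst_ray k η A)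

/-- The same, as emptiness of the structure. [folklore] -/
theorem isEmpty_openReachBound_quad (k η ε : ℝ) :
    IsEmpty (OpenReachBound 𝒟 P (quadVF k η) (loadedRegion η) ε) :=
  ⟨not_openReachBound_quad k η ε⟩

end BlockDesign

end Summit.NavierStokesRegularity.FluidComputer
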